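import Summits.BirchSwinnertonDyer.Rank1Residual.X11b.TamagawaQuadraticBaseChange
import Summits.BirchSwinnertonDyer.Rank1Residual.X11b.CastellaErratumVersionOfRecord
import Summits.BirchSwinnertonDyer.Rank1Residual.Additive.RamifiedTwistTamagawa
import Summits.BirchSwinnertonDyer.Rank1Residual.Additive.CyclotomicThreeMultiplicativeReduction
import Summits.BirchSwinnertonDyer.Rank1Residual.X2.TwistKodaira
import Literature.NumberTheory.EllipticCurves.HeegnerPointsKolyvaginGoodReductionProofs
import Literature.NumberTheory.QuadraticFields.FundamentalDiscriminant
import HarnessLib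

/-!
# X11b at `p = 3`, route R1's descent — link (C), part 1: the odd-`p` Tamagawa unit criterion and the per-place identity on erratum fields (cell `b2b-bsdres`, team `x11b3`, seat p6, sub-target R1@3-DESCENT)

HONEST FRAMING (cell `b2b-bsdres`, run/shared/lean/b2b/bsd-rank1-residual/, verbatim in every
file): the goal of the cell is to DELETE the COMBINATION-SHAPED residual classes of the
Birch–Swinnerton-Dyer formula for ALL analytic-rank `≤ 1` elliptic curves over `ℚ` — "full BSD
formula for every rank `≤ 1` curve in class `C`" assembled STRICTLY from published theorems — so
that the rank-`≤ 1` remainder becomes exactly the CONSTRUCTION-SHAPED classes, which are TYPED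
(missing-input `Prop`s), NOT attempted. This is not "finishing BSD". Team `x11b3` (N8/O2: X11b at
`p = 3`); a RESEARCH ROUTE; no claim beyond the stated class; X11 ∧ `r = 1` at `p = 3` stays
CONSTRUCTION-SHAPED / O2 OPEN; nothing here books anything or changes a label. THEOREMS ONLY (no
`def`, no named fact, no `sorry`).

## What this file proves (part 1 of the discharge of `stub_tamagawaDescentAt_three`)

Link (C) of Castella, Camb. J. Math. 6 (2018) §5 ("the immediate relation `Σ_{w∣N} c_w(E/K) =
Σ_{ℓ∣N} c_ℓ(E/ℚ) + Σ_{ℓ∣N} c_ℓ(E^D/ℚ)`", arXiv:1704.06608 p. 12), read `p`-adically, is proved by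
multr1-p1 (`X11b/TamagawaQuadraticPlaces.lean`, `X11b/TamagawaQuadraticBaseChange.lean`) for
`5 ≤ p` through a per-place identity whose non-split case uses the uniform bound "`c_v ≤ 4 < p`"
at every place that is not split multiplicative (`padicValNat_localTamagawaNumber_eq_zero`). At
`p = 3` that bound is USELESS — Kodaira types IV and IV* have `c = 3` — so the non-split places
must be analysed by reduction type. This file does so on ERRATUM fields at an odd `q`:

* `padicValNat_localTamagawaNumber_eq_zero_of_semistable` — the odd-`p` unit criterion at a place
  of GOOD or MULTIPLICATIVE reduction of an elliptic curve over a number field: `c_w = 1` (good,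
  Silverman *AEC* VII.2), `c_w = ord_w(Δ_min)` (split, Kodaira–Néron) with `p ∤ ord_w(Δ_min)` from the
  `j`-hypothesis, `c_w ∈ {1, 2}` (non-split, Tate's algorithm Step 2); no additive place allowed.
* `padicValNat_sum_fibre_eq_of_isErratumField` — the per-place identity at an odd `p` for an erratum
  field `K` at an odd `q` (`K` imaginary quadratic, `q ∣ d_K`, every prime of `N_E` other than `q`
  split, `2` split if `2 ∤ N_E`): at a SPLIT place as in multr1-p1 (`c_w = c_w̄ = c_ℓ(E) = c_ℓ(E^D)`);
  at a NON-SPLIT place `v ↔ ℓ`, `E` is good at `ℓ` or `ℓ = q` is multiplicative with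
  `p ∤ ord_q(Δ_min)` — SEMISTABLE either way, and so is `E_K` at the place above
  (`hasGoodReductionAt_baseChange_of_hasGoodReductionAt_rat`;
  `Additive.isMinimalAt_and_hasMultiplicativeReductionAt_baseChange_of_mult`; ramification index
  `e ≤ 2 < p` for the `j`-hypothesis, `jHyp_baseChange`); the TWIST `E^{(d_K)}` at `ℓ` is good when
  `ℓ ∤ d_K` (`d_K ≡ 1 (mod 8)` on an erratum field at an odd `q`, so the twist is unramified at
  `ℓ`: `X2.hasGoodReductionAt_twist_of_not_dvd`, any `ℓ` including `2`) and of Kodaira type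
  `I₀*`/`Iₙ*` when `ℓ ∣ d_K` (then `ℓ` is odd and `ℓ ∥ d_K`:
  `Additive.tamagawaNumberAt_twist_of_semistable_mem`, `c_ℓ(E^D) ∈ {1, 2, 4}`) — a `p`-unit for every
  odd `p`.

Part 2 (`Three/RouteR1Tamagawa.lean`) assembles the products and discharges the stub. Elementary
local arithmetic; nothing about STEP L itself. The point for the team: at `p = 3` the Tamagawa
bookkeeping of Castella's §5 descent holds on erratum fields for the STRUCTURAL reason that every
bad place of `E`, `E_K`, `E^{(d_K)}` met there is semistable or a ramified quadratic twist of a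
semistable one (types `I₀*`, `Iₙ*`: `c ∈ {1,2,4}`), never of type IV/IV*.

References: [Castella2018] §5 (arXiv:1704.06608 p. 12); [SilvermanAEC2009] VII.2 (remark after
Prop. 2.1), VII.5 Prop. 5.1, VII.6 Thm. 6.1; [SilvermanATAEC1994] IV.9.4 Steps 2, 6, 7; S. Comalada,
J. Number Theory 49 (1994) §2; [Marcus1977] Ch. 2 (no odd square divides `d_K`).
-/

noncomputable section

open scoped Classical

open WeierstrassCurve NumberField IsDedekindDomain Literature.NumberTheory.EllipticCurves
  Literature.NumberTheory.EllipticCurves.Rank1Residual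

namespace Summit.BirchSwinnertonDyer.Rank1Residual.X11b.Three

/-! ### The odd-`p` unit criterion at a semistable place -/

section Criterion

variable {K : Type*} [Field K] [NumberField K] (X : WeierstrassCurve K) [X.IsElliptic]
  (w : HeightOneSpectrum (𝓞 K))

/-- **`p ∤ c_w` at a SEMISTABLE place, `p` odd.** For an elliptic curve `X` over a number field `K`,
a finite place `w` of good or multiplicative reduction, and an odd prime `p` such that every
positive `n` with `|j(X)|_w = exp(n)` (i.e. `ord_w(j) = −n < 0`) is prime to `p`: `p ∤ c_w`. Good
reduction: `c_w = 1` (Silverman *AEC* VII.2, remark after Prop. 2.1,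
`localTamagawaNumber_eq_one_of_good'`); split multiplicative: `c_w = ord_w(Δ_min) = −ord_w(j)`
(Kodaira–Néron, `kodairaNeron_localTamagawaNumber`, `valuation_j_eq_exp_ordMinimalDiscriminant`);
non-split multiplicative: `c_w ∈ {1, 2}` (Tate's algorithm Step 2,
`localTamagawaNumber_of_hasNonsplitMultiplicativeReductionAt_holds`). The additive case of
multr1-p1's `padicValNat_localTamagawaNumber_eq_zero` ("`c_w ≤ 4 < p`") is exactly what fails at
`p = 3`; it is excluded here by hypothesis. [cite: SilvermanAEC2009, Thm VII.6.1]
[cite: SilvermanATAEC1994, IV.9.4 Step 2 (PDF p. 344)] -/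
theorem padicValNat_localTamagawaNumber_eq_zero_of_semistable {p : ℕ} [Fact p.Prime] (hp2 : p ≠ 2)
    (hsemi : X.HasGoodReductionAt w ∨ X.HasMultiplicativeReductionAt w)
    (hj : ∀ n : ℕ, 0 < n → w.valuation K X.j = WithZero.exp (n : ℤ) → ¬ p ∣ n) :
    padicValNat p
      ((X.baseChange (w.adicCompletion K)).localTamagawaNumber (w.adicCompletionIntegers K)) = 0 := by
  have hpP : p.Prime := Fact.out
  haveI : Finite (IsLocalRing.ResidueField (w.adicCompletionIntegers K)) :=
    HeightOneSpectrum.finite_residueField_adicCompletionIntegers K w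
  refine padicValNat.eq_zero_of_not_dvd fun hdvd => ?_
  rcases hsemi with hgood | hmult
  · rw [localTamagawaNumber_eq_one_of_good' w X
      (WeierstrassCurve.localTamagawaNumber_eq_one_of_hasGoodReduction_holds _ _) hgood] at hdvd
    exact hpP.one_lt.ne' (Nat.dvd_one.mp hdvd)
  · by_cases hs : X.HasSplitMultiplicativeReductionAt w
    · obtain ⟨-, hsplit, -⟩ := kodairaNeron_localTamagawaNumber X w
      rw [hsplit hs] at hdvd
      exact hj _ (ordMinimalDiscriminant_pos_of_hasMultiplicativeReductionAt w X hmult)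
        (valuation_j_eq_exp_ordMinimalDiscriminant w X hmult) hdvd
    · rw [localTamagawaNumber_of_hasNonsplitMultiplicativeReductionAt_holds w X hmult hs] at hdvd
      split_ifs at hdvd
      · exact hp2 ((Nat.prime_dvd_prime_iff_eq hpP Nat.prime_two).mp hdvd)
      · exact hpP.one_lt.ne' (Nat.dvd_one.mp hdvd)

end Criterion

/-! ### The per-place identity on an erratum field, every odd `p` -/

section PerPlace

/-- **The Tamagawa relation, one rational place at a time, at an ODD prime `p` on an ERRATUM
field.** Let `W/ℚ` be globally minimal elliptic, `p` an odd prime, `q` an ODD prime of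
multiplicative reduction with `p ∤ ord_q(Δ_min)`, `K` an erratum field for `q` (`K` imaginary
quadratic, `q ∣ d_K`, every prime of `N_E` other than `q` split in `K`, `2` split if `2 ∤ N_E`,
`L(E^{(d_K)},1) ≠ 0`), and `Wd = C • W^{(d_K)}` an elliptic model of the twist. Then for every finite
place `v` of `ℚ`: `Σ_{w ∣ v} ord_p c_w(E_K) = ord_p c_v(E) + ord_p c_v(E^{(d_K)})` and
`ord_p c_v(E^{(d_K)}) = ord_p c_v(E)`. Split `v`: both places above have `c_w = c_v(E)` and
`c_v(E^{(d)}) = c_v(E)` (`d_K ∈ (ℚ_ℓ^×)²`). Non-split `v ↔ ℓ`: `E` is good at `ℓ` or `ℓ = q` (all other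
bad primes split), hence `E` and `E_K` are SEMISTABLE at `v`, resp. at the place above, with
`p ∤ ord(Δ_min)` in the multiplicative case (`e(w|v) ≤ 2 < p`), so their `c` are `p`-units
(`padicValNat_localTamagawaNumber_eq_zero_of_semistable`); the twist is good at `ℓ ∤ d_K` (`d_K ≡ 1
(mod 8)`: unramified twist, `X2.hasGoodReductionAt_twist_of_not_dvd`), and of Kodaira type `I₀*` or
`Iₙ*` with `c ∈ {1, 2, 4}` at `ℓ ∣ d_K` (`ℓ` odd, `ℓ ∥ d_K`;
`Additive.tamagawaNumberAt_twist_of_semistable_mem`). multr1-p1's `padicValNat_sum_fibre_eq` is the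
case `5 ≤ p` (there also `q = 2` and inert multiplicative primes are allowed).
[cite: Castella2018, §5 (arXiv:1704.06608 p. 12), Tamagawa relation]
[cite: SilvermanATAEC1994, IV.9.4 Steps 6–7 (PDF pp. 345–346)] -/
theorem padicValNat_sum_fibre_eq_of_isErratumField (W : WeierstrassCurve ℚ) [W.IsElliptic]
    [W.IsGloballyMinimal] (p : ℕ) [Fact p.Prime] (hp2 : p ≠ 2) (K : Type) [Field K] [NumberField K]
    [(W.baseChange K).IsElliptic] {q : ℕ} [Fact q.Prime] (hq2 : q ≠ 2) (hmq : Mult W q)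
    (hvq : ¬ p ∣ padicValInt q W.minimalDiscriminantInt) (hK : IsErratumField W K q)
    (Wd : WeierstrassCurve ℚ) [Wd.IsElliptic] {C : VariableChange ℚ}
    (hC : C • W.quadraticTwist (NumberField.discr K : ℚ) = Wd) (v : HeightOneSpectrum (𝓞 ℚ)) :
    (∑ w ∈ (HeightOneSpectrum.finite_setOf_under_eq_of_numberField (K := K) v).toFinset,
        padicValNat p (((W.baseChange K).baseChange (w.adicCompletion K)).localTamagawaNumber
          (w.adicCompletionIntegers K)) =
      padicValNat p ((W.baseChange (v.adicCompletion ℚ)).localTamagawaNumber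
          (v.adicCompletionIntegers ℚ)) +
        padicValNat p ((Wd.baseChange (v.adicCompletion ℚ)).localTamagawaNumber
          (v.adicCompletionIntegers ℚ))) ∧
    padicValNat p ((Wd.baseChange (v.adicCompletion ℚ)).localTamagawaNumber
        (v.adicCompletionIntegers ℚ)) =
      padicValNat p ((W.baseChange (v.adicCompletion ℚ)).localTamagawaNumber
        (v.adicCompletionIntegers ℚ)) := by
  have hpr : p.Prime := Fact.out
  have hqP : q.Prime := Fact.out
  have h2 : Module.finrank ℚ K = 2 := hK.1.1
  set ℓ : ℕ := (Rat.HeightOneSpectrum.primesEquiv v : ℕ) with hℓdef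
  haveI hℓ : Fact ℓ.Prime := ⟨(Rat.HeightOneSpectrum.primesEquiv v).2⟩
  have hvℓ : (Rat.HeightOneSpectrum.primesEquiv v : ℕ) = ℓ := rfl
  have hd : (NumberField.discr K : ℚ) ≠ 0 := by exact_mod_cast NumberField.discr_ne_zero K
  have hdZ : (NumberField.discr K : ℤ) ≠ 0 := NumberField.discr_ne_zero K
  have hfin := HeightOneSpectrum.finite_setOf_under_eq_of_numberField (K := K) v
  -- `d_K ≡ 1 (mod 8)` and `2 ∤ d_K` on an erratum field at an odd `q`
  have h8 : NumberField.discr K % 8 = 1 := hK.discr_emod_eight hq2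
  have hodd2 : ¬ (2 : ℤ) ∣ NumberField.discr K := (hK.not_two_dvd_discr_iff).mpr hq2
  -- the case of a single place `w` above `v` (inert or ramified): all three numbers are `p`-units
  have key : ∀ (w : HeightOneSpectrum (𝓞 K)) (e : ℕ),
      {w' : HeightOneSpectrum (𝓞 K) | w'.under (𝓞 ℚ) = v} = {w} →
      w.asIdeal.ramificationIdx (𝓞 ℚ) = e → 0 < e → e ≤ 2 →
      (∑ w ∈ hfin.toFinset,
          padicValNat p (((W.baseChange K).baseChange (w.adicCompletion K)).localTamagawaNumber
            (w.adicCompletionIntegers K)) =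
        padicValNat p ((W.baseChange (v.adicCompletion ℚ)).localTamagawaNumber
            (v.adicCompletionIntegers ℚ)) +
          padicValNat p ((Wd.baseChange (v.adicCompletion ℚ)).localTamagawaNumber
            (v.adicCompletionIntegers ℚ))) ∧
      padicValNat p ((Wd.baseChange (v.adicCompletion ℚ)).localTamagawaNumber
          (v.adicCompletionIntegers ℚ)) =
        padicValNat p ((W.baseChange (v.adicCompletion ℚ)).localTamagawaNumber
          (v.adicCompletionIntegers ℚ)) := by
    intro w e hset he he0 he2
    have hw : w.under (𝓞 ℚ) = v := by
      have h : w ∈ ({w} : Set (HeightOneSpectrum (𝓞 K))) := Set.mem_singleton _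
      rwa [← hset] at h
    haveI : w.asIdeal.LiesOver v.asIdeal := ⟨by rw [← hw]; rfl⟩
    have hF : hfin.toFinset = {w} := by
      ext w'
      rw [Set.Finite.mem_toFinset, hset]
      simp
    -- `ℓ` does not split in `K`
    have hns : ¬ SplitsIn K ℓ := by
      show ((Ideal.span {(ℓ : ℤ)}).primesOver (𝓞 K)).ncard ≠ 2
      rw [hℓdef, ncard_primesOver_span_eq K v, hset, Set.ncard_singleton]
      decide
    -- so a bad `ℓ` is the ramified prime `q`
    have hℓq : ℓ ∣ W.conductorNorm ℤ → ℓ = q := fun hℓN => by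
      by_contra hne
      exact hns (hK.2.2.1 ℓ hℓ.out hℓN hne)
    -- `E` is semistable at `v`, with the `p`-adic `j`-hypothesis
    have hsemiW : W.HasGoodReductionAt v ∨ W.HasMultiplicativeReductionAt v := by
      by_cases hℓN : ℓ ∣ W.conductorNorm ℤ
      · exact Or.inr ((hasMultiplicativeReductionAtPrime_primesEquiv_iff_holds W v q (hℓq hℓN)).mp hmq)
      · exact Or.inl ((hasGoodReductionAtPrime_primesEquiv_iff_holds W v ℓ hvℓ).mp
          (by
            by_contra hbad'
            exact hℓN ((W.dvd_conductorNorm_iff_not_hasGoodReductionAtPrime ℓ).mpr hbad')))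
    have H : ∀ n : ℕ, 0 < n → v.valuation ℚ W.j = WithZero.exp (n : ℤ) → ¬ p ∣ n := by
      by_cases hℓN : ℓ ∣ W.conductorNorm ℤ
      · have hmv : W.HasMultiplicativeReductionAt v :=
          (hasMultiplicativeReductionAtPrime_primesEquiv_iff_holds W v q (hℓq hℓN)).mp hmq
        intro n hn hval
        rw [valuation_j_eq_exp_ordMinimalDiscriminant v W hmv, WithZero.exp_inj] at hval
        have hn' : n = W.ordMinimalDiscriminant v := by exact_mod_cast hval.symm
        rw [hn', ordMinimalDiscriminant_eq_padicValInt W v (hℓq hℓN)]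
        exact hvq
      · have hgood : W.HasGoodReductionAt v :=
          (hasGoodReductionAtPrime_primesEquiv_iff_holds W v ℓ hvℓ).mp
            (by
              by_contra hbad'
              exact hℓN ((W.dvd_conductorNorm_iff_not_hasGoodReductionAtPrime ℓ).mpr hbad'))
        have hj := Additive.valuation_j_le_one_of_hasGoodReductionAt W v hgood
        intro n hn hval
        exfalso
        rw [hval, ← WithZero.exp_zero, WithZero.exp_le_exp] at hj
        omega
    -- `E_K` is semistable at `w`
    have hsemiK : (W.baseChange K).HasGoodReductionAt w ∨
        (W.baseChange K).HasMultiplicativeReductionAt w := by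
      by_cases hℓN : ℓ ∣ W.conductorNorm ℤ
      · -- `w ∣ q`: multiplicative reduction is stable under base change
        have hvq' : v = (Rat.HeightOneSpectrum.primesEquiv (R := 𝓞 ℚ)).symm ⟨q, hqP⟩ := by
          rw [Equiv.eq_symm_apply]; exact Subtype.ext (hℓq hℓN)
        have hqv : (q : 𝓞 ℚ) ∈ v.asIdeal :=
          (natCast_mem_asIdeal_iff_eq_primesEquiv_symm v hqP).mpr hvq'
        have hmem : (q : 𝓞 ℚ) ∈ (w.under (𝓞 ℚ)).asIdeal := by rw [hw]; exact hqv
        rw [HeightOneSpectrum.under_asIdeal, Ideal.under_def, Ideal.mem_comap, map_natCast] at hmem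
        exact Or.inr
          (Additive.isMinimalAt_and_hasMultiplicativeReductionAt_baseChange_of_mult W hmq w hmem).2
      · have hgood : W.HasGoodReductionAt v :=
          (hasGoodReductionAtPrime_primesEquiv_iff_holds W v ℓ hvℓ).mp
            (by
              by_contra hbad'
              exact hℓN ((W.dvd_conductorNorm_iff_not_hasGoodReductionAtPrime ℓ).mpr hbad'))
        exact Or.inl (hasGoodReductionAt_baseChange_of_hasGoodReductionAt_rat W v w hgood)
    have hep : e < p := lt_of_le_of_lt he2 (by have := hpr.two_le; omega)
    have hQ := padicValNat_localTamagawaNumber_eq_zero_of_semistable W v hp2 hsemiW H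
    have hKw := padicValNat_localTamagawaNumber_eq_zero_of_semistable (W.baseChange K) w hp2 hsemiK
      (jHyp_baseChange W K w v hw hpr he he0 hep H)
    -- the twist at `v`
    have hD : padicValNat p ((Wd.baseChange (v.adicCompletion ℚ)).localTamagawaNumber
        (v.adicCompletionIntegers ℚ)) = 0 := by
      by_cases hℓd : ((Rat.HeightOneSpectrum.primesEquiv v : ℕ) : ℤ) ∣ NumberField.discr K
      · -- ramified `ℓ ∣ d_K`: `ℓ` odd, `ℓ ∥ d_K`, twist of Kodaira type `I₀*`/`Iₙ*`, `c ∈ {1, 2, 4}`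
        have hℓ2 : (Rat.HeightOneSpectrum.primesEquiv v : ℕ) ≠ 2 := by
          intro h
          apply hodd2
          have h' : (((Rat.HeightOneSpectrum.primesEquiv v : ℕ) : ℤ)) = 2 := by rw [h]; rfl
          rwa [h'] at hℓd
        have hsq : ¬ ((Rat.HeightOneSpectrum.primesEquiv v : ℕ) : ℤ) ^ 2 ∣ NumberField.discr K :=
          Literature.NumberTheory.QuadraticFields.Quadratic.not_sq_dvd_discr_of_prime_ne_two h2
            hℓ.out hℓ2
        have hmem := Additive.tamagawaNumberAt_twist_of_semistable_mem v W hℓ2 hdZ hℓd hsq hsemiW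
          C hC
        rw [tamagawaNumberAt_def] at hmem
        have h4 : ¬ p ∣ 4 := fun h => hp2 ((Nat.prime_dvd_prime_iff_eq hpr Nat.prime_two).mp
          (hpr.dvd_of_dvd_pow (show p ∣ 2 ^ 2 by simpa using h)))
        have h2' : ¬ p ∣ 2 := fun h => hp2 ((Nat.prime_dvd_prime_iff_eq hpr Nat.prime_two).mp h)
        rcases hmem with h | h | h <;> rw [h]
        · simp
        · exact padicValNat.eq_zero_of_not_dvd h2'
        · exact padicValNat.eq_zero_of_not_dvd h4
      · -- unramified `ℓ ∤ d_K`: `E` is good at `v` (a bad `ℓ` would be `q ∣ d_K`), so is the twist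
        have hℓN : ¬ ℓ ∣ W.conductorNorm ℤ := fun hℓN => by
          apply hℓd
          rw [hvℓ, hℓq hℓN]
          exact hK.2.1
        have hgood : W.HasGoodReductionAt v :=
          (hasGoodReductionAtPrime_primesEquiv_iff_holds W v ℓ hvℓ).mp
            (by
              by_contra hbad'
              exact hℓN ((W.dvd_conductorNorm_iff_not_hasGoodReductionAtPrime ℓ).mpr hbad'))
        have hDk : NumberField.discr K = 4 * ((NumberField.discr K - 1) / 4) + 1 := by omega
        have hgoodd : Wd.HasGoodReductionAt v :=
          X2.hasGoodReductionAt_twist_of_not_dvd W v hDk hℓd hgood C hC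
        rw [localTamagawaNumber_eq_one_of_good' v Wd
          (WeierstrassCurve.localTamagawaNumber_eq_one_of_hasGoodReduction_holds _ _) hgoodd]
        simp
    rw [hF, Finset.sum_singleton, hKw, hQ, hD]
    exact ⟨rfl, rfl⟩
  rcases placesOver_trichotomy_of_finrank_eq_two K h2 v with
    ⟨w₁, w₂, hne, hset, hef⟩ | ⟨w, hset, he, -⟩ | ⟨w, hset, he, -⟩
  · -- split: two places of degree one, and `d_K` is a square in `ℚ_ℓ`
    have hw₁ : w₁.under (𝓞 ℚ) = v := by
      have h : w₁ ∈ ({w₁, w₂} : Set (HeightOneSpectrum (𝓞 K))) := Set.mem_insert _ _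
      rwa [← hset] at h
    have hw₂ : w₂.under (𝓞 ℚ) = v := by
      have h : w₂ ∈ ({w₁, w₂} : Set (HeightOneSpectrum (𝓞 K))) :=
        Set.mem_insert_of_mem _ (Set.mem_singleton _)
      rwa [← hset] at h
    obtain ⟨he₁, hf₁⟩ := hef w₁ hw₁
    obtain ⟨he₂, hf₂⟩ := hef w₂ hw₂
    have hF : hfin.toFinset = {w₁, w₂} := by
      ext w
      rw [Set.Finite.mem_toFinset, hset]
      simp
    have hs : SplitsIn K ℓ := by
      show ((Ideal.span {(ℓ : ℤ)}).primesOver (𝓞 K)).ncard = 2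
      rw [hℓdef, ncard_primesOver_span_eq K v, hset, Set.ncard_pair hne]
    have hsq := isSquare_padic_discr_of_splitsIn h2 hs
    have c₁ := localTamagawaNumber_baseChange_eq_of_degree_one W w₁ he₁ hf₁
    have c₂ := localTamagawaNumber_baseChange_eq_of_degree_one W w₂ he₂ hf₂
    rw [hw₁] at c₁
    rw [hw₂] at c₂
    rw [hF, Finset.sum_pair hne, c₁, c₂,
      localTamagawaNumber_eq_of_twist_of_isSquare W v hvℓ hd hsq Wd hC]
    exact ⟨rfl, rfl⟩
  · exact key w 1 hset he one_pos (by norm_num)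
  · exact key w 2 hset he two_pos le_rfl

end PerPlace

end Summit.BirchSwinnertonDyer.Rank1Residual.X11b.Three

end
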